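import Summits.QuantumFields.YangMills.Theorems.UnitScaleTiltProp7CovKernelOfTransplant
import Summits.QuantumFields.YangMills.Theorems.UnitScaleTiltProp7TransplantTwoGen
import Summits.QuantumFields.YangMills.Theorems.UnitScaleTiltProp7TransplantNorms
import HarnessLib

/-!
# Route `UnitScaleTilt`, crux K1 «MinimiserStabilityRegPr» (stmt-QuantumFields-19200), route-R E′ path (α′), (E1-b) at the CURVED background — THE (A-cov) TRANSPLANT ASSEMBLY:
# THE BODY OF `htr` (✓p677235 `sqrt_hs_covD_interp_error_le_of_transplant` ∕ `hKsup_of_transplant_T3`) FOR ONE TEST MATRIX `X`, FROM DISPLAYED gen-0 ROWS (✓p678469∕p679067∕`…NearDatum`), gen-1 FIELDS IN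
# routeR-w6 g6's ✓p678447 LETTERS (`F J m E₁ E₂ K₁ K₂`, `hK₁ hK₂ hF hJ` verbatim, `m` vanishing off the centres, a near datum `u₁` for `R(Fr)F`) AND TEN NUMBERS — `V := ψ•R(Fr)X − R(Fr)F`,
# `h := E₁ + c₁•R(Fr)X − K₁`, `s := c₂•R(Fr)X − K₂`, door cutoff `χ := 1` (so `N_h = 0`), `u := ψ̃•R(Fr)X − u₁`, the pole ANCHOR `Fr b = 1`, `Fr(b + e_μ) = U_μ(b)⁻¹` turning `(Δg)•R(Fr)X` into the exact covariant dipole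

Cell `ym3-torus`, width seat `ym3-torus-px22` (gen 3).  THEOREMS ONLY (0 `def`, 0 `sorry`); `--supports stmt-QuantumFields-19200`, count-neutral.  YM₃ on T³ is a ladder rung (R3), not the Clay problem; nothing here
claims the stub, the crux, d = 4 or the gap.

WHAT IS PROVED (ns `…Theorems.Prop7CovKernelTransplantAssembly`; torus `Site P i`, `T = torusT P i`, unit field `U`, frame `Fr`, centres `C : Set`, `hs X = Σ‖X j k‖²`).
* §1 letters: ★ `sqrt_weighted_hs_add_le` ∕ `sqrt_weighted_hs_sub_le` (weighted Minkowski in `hs` letters), `sqrt_weighted_hs_covLaplace_sub_le`, `frame_shift_pole_eq_inv` (the ANCHOR: a framed link equal to `1` at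
  the pole with `Fr b = 1` forces `Fr(T_μ b) = (U_μ b)⁻¹`), `dipole_smul_R_eq` (`(𝟙_{b+e_μ} − 𝟙_b)(z)•R(Fr z)X = [z = T_μ b]·R(U_μ b)⁻¹X − [z = b]·X`).
* §2 ★★★ `htr_body_of_rows` — the conclusion is LITERALLY the `∃ V h s χ u Nh N₂ N₃ N₄ H S, …` body of ✓p677235's `htr` at `X`, with `Nh := 0`, `N₂ := N2₀ + N2₁`, `N₃ := N3₀ + N3₁`, `N₄ := N4₀ + N4₁`,
  `H := H₀ + H₁`, `S := S₀ + S₁`, given the displayed total `0·… + (N2₀+N2₁) + (N3₀+N3₁) + W·3(N4₀+N4₁) + W·(3(H₀+H₁) + 5A(S₀+S₁)) ≤ κ·√hs X`.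
HONEST SCOPE.  Pure assembly; every number is a hypothesis (gen-0's are ✓p679067∕`…NearDatum` at the member, gen-1's are routeR-w6's), and the member's frame∕weight∕Poincaré rows are the last file.

References: T. Bałaban, CMP 99 (1985) 389–434 [Balaban1985BackgroundPropagators] ((3.3) p.390, (3.8) p.392, (3.35) p.396); CMP 99 (1985) 75–102 [Balaban1985RegularSpaces] ((1.14) p.78, (1.36) p.82);
CMP 96 (1984) 223–250 [Balaban1984PropagatorsII] ((1.9) p.226).
-/

set_option autoImplicit false

noncomputable section

open scoped BigOperators Matrix.Norms.L2Operator Matrix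

namespace Summit.QuantumFields.YangMills.Theorems.Prop7CovKernelTransplantAssembly

open Literature.MathematicalPhysics.QuantumFieldTheory.Balaban1983to89
open B9Eq39Adjoint (R R_def covD covDstar divB)
open B9TorusCalculus (torusT torusT_apply torusT_symm_apply)
open Summit.QuantumFields.YangMills.Theorems.Prop7CovInterpKernelDual (covLaplace_sub)
open Summit.QuantumFields.YangMills.Theorems.Prop7CovPinnedKernelL1OfRows (sqrt_hs_add_le sqrt_hs_sub_le sum_sqrt_hs_covLaplace_sub_le)
open Summit.QuantumFields.YangMills.Theorems.Prop7CovKernelOfTransplant (covLaplace_zero)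
open Summit.QuantumFields.YangMills.Theorems.Prop7TransplantTwoGen (covBilaplace_two_generation')
open Summit.QuantumFields.YangMills.Theorems.Prop7TransplantNorms (covLaplace_eq_zero_of_vanish)

variable {P : Params} {i : ℕ} {N : ℕ}

/-! ## §1 Letters -/

/-- ★ **WEIGHTED MINKOWSKI IN `hs` LETTERS**: `√(Σ_z ω z²·hs(A z + B z)) ≤ √(Σ ω²hs A) + √(Σ ω²hs B)`. [cite: Balaban1984PropagatorsII, (1.9) p.226] -/
theorem sqrt_weighted_hs_add_le (ω : Site P i → ℝ) (A B : Site P i → Matrix (Fin N) (Fin N) ℂ) :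
    Real.sqrt (∑ z, ω z ^ 2 * ∑ j : Fin N, ∑ k : Fin N, ‖(A z + B z) j k‖ ^ 2)
      ≤ Real.sqrt (∑ z, ω z ^ 2 * ∑ j : Fin N, ∑ k : Fin N, ‖(A z) j k‖ ^ 2) + Real.sqrt (∑ z, ω z ^ 2 * ∑ j : Fin N, ∑ k : Fin N, ‖(B z) j k‖ ^ 2) := by
  set a : Site P i → ℝ := fun z => |ω z| * Real.sqrt (∑ j : Fin N, ∑ k : Fin N, ‖(A z) j k‖ ^ 2) with ha
  set b : Site P i → ℝ := fun z => |ω z| * Real.sqrt (∑ j : Fin N, ∑ k : Fin N, ‖(B z) j k‖ ^ 2) with hb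
  have hnn : ∀ (X : Matrix (Fin N) (Fin N) ℂ), 0 ≤ ∑ j : Fin N, ∑ k : Fin N, ‖X j k‖ ^ 2 := fun X => Finset.sum_nonneg fun _ _ => Finset.sum_nonneg fun _ _ => sq_nonneg _
  have hA : ∑ z, ω z ^ 2 * ∑ j : Fin N, ∑ k : Fin N, ‖(A z) j k‖ ^ 2 = ∑ z, a z ^ 2 := Finset.sum_congr rfl fun z _ => by
    rw [ha]; simp only; rw [mul_pow, sq_abs, Real.sq_sqrt (hnn _)]
  have hB : ∑ z, ω z ^ 2 * ∑ j : Fin N, ∑ k : Fin N, ‖(B z) j k‖ ^ 2 = ∑ z, b z ^ 2 := Finset.sum_congr rfl fun z _ => by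
    rw [hb]; simp only; rw [mul_pow, sq_abs, Real.sq_sqrt (hnn _)]
  have hle : ∑ z, ω z ^ 2 * ∑ j : Fin N, ∑ k : Fin N, ‖(A z + B z) j k‖ ^ 2 ≤ ∑ z, (a z + b z) ^ 2 := by
    refine Finset.sum_le_sum fun z _ => ?_
    have h1 : ω z ^ 2 * ∑ j : Fin N, ∑ k : Fin N, ‖(A z + B z) j k‖ ^ 2 = (|ω z| * Real.sqrt (∑ j : Fin N, ∑ k : Fin N, ‖(A z + B z) j k‖ ^ 2)) ^ 2 := by
      rw [mul_pow, sq_abs, Real.sq_sqrt (hnn _)]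
    rw [h1]
    have h2 : |ω z| * Real.sqrt (∑ j : Fin N, ∑ k : Fin N, ‖(A z + B z) j k‖ ^ 2) ≤ a z + b z := by
      rw [ha, hb]; simp only; rw [← mul_add]
      exact mul_le_mul_of_nonneg_left (sqrt_hs_add_le _ _) (abs_nonneg _)
    exact pow_le_pow_left₀ (mul_nonneg (abs_nonneg _) (Real.sqrt_nonneg _)) h2 2
  -- real Minkowski
  set SA := Real.sqrt (∑ z, a z ^ 2) with hSA
  set SB := Real.sqrt (∑ z, b z ^ 2) with hSB
  have hcs : ∑ z, a z * b z ≤ SA * SB := Real.sum_mul_le_sqrt_mul_sqrt _ a b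
  have hsum : ∑ z, (a z + b z) ^ 2 = ∑ z, a z ^ 2 + 2 * ∑ z, a z * b z + ∑ z, b z ^ 2 := by
    rw [Finset.mul_sum, ← Finset.sum_add_distrib, ← Finset.sum_add_distrib]
    exact Finset.sum_congr rfl fun x _ => by ring
  have hA2 : SA ^ 2 = ∑ z, a z ^ 2 := Real.sq_sqrt (Finset.sum_nonneg fun _ _ => sq_nonneg _)
  have hB2 : SB ^ 2 = ∑ z, b z ^ 2 := Real.sq_sqrt (Finset.sum_nonneg fun _ _ => sq_nonneg _)
  rw [hA, hB, ← hSA, ← hSB]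
  refine (Real.sqrt_le_sqrt hle).trans ?_
  rw [← Real.sqrt_sq (add_nonneg (Real.sqrt_nonneg _) (Real.sqrt_nonneg _) : 0 ≤ SA + SB)]
  apply Real.sqrt_le_sqrt
  nlinarith

/-- the subtraction twin: `√(Σω²hs(A − B)) ≤ √(Σω²hs A) + √(Σω²hs B)`. [cite: Balaban1984PropagatorsII, (1.9) p.226] -/
theorem sqrt_weighted_hs_sub_le (ω : Site P i → ℝ) (A B : Site P i → Matrix (Fin N) (Fin N) ℂ) :
    Real.sqrt (∑ z, ω z ^ 2 * ∑ j : Fin N, ∑ k : Fin N, ‖(A z - B z) j k‖ ^ 2)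
      ≤ Real.sqrt (∑ z, ω z ^ 2 * ∑ j : Fin N, ∑ k : Fin N, ‖(A z) j k‖ ^ 2) + Real.sqrt (∑ z, ω z ^ 2 * ∑ j : Fin N, ∑ k : Fin N, ‖(B z) j k‖ ^ 2) := by
  have h := sqrt_weighted_hs_add_le ω A (fun z => -B z)
  have e1 : ∀ z, A z + -B z = A z - B z := fun z => by abel
  have e2 : ∀ z, (∑ j : Fin N, ∑ k : Fin N, ‖(-B z) j k‖ ^ 2) = ∑ j : Fin N, ∑ k : Fin N, ‖(B z) j k‖ ^ 2 := fun z => by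
    simp only [Matrix.neg_apply, norm_neg]
  simp only [e1, e2] at h
  exact h

/-- `√(Σω²hs(Δ_U(A − B))) ≤ √(Σω²hs(Δ_U A)) + √(Σω²hs(Δ_U B))`. [cite: Balaban1985BackgroundPropagators, (3.8) p.392] -/
theorem sqrt_weighted_hs_covLaplace_sub_le (U : Fin P.d → Site P i → (Matrix (Fin N) (Fin N) ℂ)ˣ) (ω : Site P i → ℝ) (A B : Site P i → Matrix (Fin N) (Fin N) ℂ) :
    Real.sqrt (∑ z, ω z ^ 2 * ∑ j : Fin N, ∑ k : Fin N, ‖(divB (torusT P i) U (fun μ => covD (torusT P i) U μ (fun y => A y - B y)) z) j k‖ ^ 2)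
      ≤ Real.sqrt (∑ z, ω z ^ 2 * ∑ j : Fin N, ∑ k : Fin N, ‖(divB (torusT P i) U (fun μ => covD (torusT P i) U μ A) z) j k‖ ^ 2)
        + Real.sqrt (∑ z, ω z ^ 2 * ∑ j : Fin N, ∑ k : Fin N, ‖(divB (torusT P i) U (fun μ => covD (torusT P i) U μ B) z) j k‖ ^ 2) := by
  have e : ∀ z, divB (torusT P i) U (fun μ => covD (torusT P i) U μ (fun y => A y - B y)) z
      = divB (torusT P i) U (fun μ => covD (torusT P i) U μ A) z - divB (torusT P i) U (fun μ => covD (torusT P i) U μ B) z := fun z => covLaplace_sub A B z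
  simp only [e]
  exact sqrt_weighted_hs_sub_le ω _ _

/-- **THE ANCHOR**: if `Fr b = 1` and the framed link at the pole is within `0` of `1` (FILE C ✓p674872's cone size row `≤ a′·tdist(b, b) = 0`), then `Fr(T_μ b) = (U_μ b)⁻¹`.
[cite: Balaban1985BackgroundPropagators, (3.28) p.395, (3.35) p.396] -/
theorem frame_shift_pole_eq_inv (U : Fin P.d → Site P i → (Matrix (Fin N) (Fin N) ℂ)ˣ) (Fr : Site P i → (Matrix (Fin N) (Fin N) ℂ)ˣ) (b : Site P i) (μ : Fin P.d)
    (hFr1 : Fr b = 1) (h0 : ‖(((Fr b)⁻¹ * U μ b * Fr (torusT P i μ b) : (Matrix (Fin N) (Fin N) ℂ)ˣ) : Matrix (Fin N) (Fin N) ℂ) - 1‖ ≤ 0) :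
    Fr (torusT P i μ b) = (U μ b)⁻¹ := by
  have h1 : (((Fr b)⁻¹ * U μ b * Fr (torusT P i μ b) : (Matrix (Fin N) (Fin N) ℂ)ˣ) : Matrix (Fin N) (Fin N) ℂ) = 1 := by
    have := norm_le_zero_iff.1 h0
    exact sub_eq_zero.1 this
  have h2 : (Fr b)⁻¹ * U μ b * Fr (torusT P i μ b) = 1 := Units.ext (by rw [Units.val_one]; exact h1)
  rw [hFr1, inv_one, one_mul] at h2
  exact eq_inv_of_mul_eq_one_right h2 |>.symm ▸ (eq_inv_of_mul_eq_one_right h2 ▸ rfl)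

/-- **THE DIPOLE LETTER**: with the anchor, `((𝟙[z = T_μ b] − 𝟙[z = b]) + c)•R(Fr z)X = ([z = T_μ b]·R(U_μ b)⁻¹X − [z = b]·X) + c•R(Fr z)X`. [cite: Balaban1985BackgroundPropagators, (3.3) p.390] -/
theorem dipole_smul_R_eq [DecidableEq (Site P i)] (U : Fin P.d → Site P i → (Matrix (Fin N) (Fin N) ℂ)ˣ) (Fr : Site P i → (Matrix (Fin N) (Fin N) ℂ)ˣ) (b : Site P i) (μ : Fin P.d)
    (hFr1 : Fr b = 1) (hpole : Fr (torusT P i μ b) = (U μ b)⁻¹) (X : Matrix (Fin N) (Fin N) ℂ) (c : ℝ) (z : Site P i) :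
    (((if z = b.shift μ then (1 : ℝ) else 0) - (if z = b then (1 : ℝ) else 0)) + c) • R (Fr z) X
      = ((if z = torusT P i μ b then R (U μ b)⁻¹ X else 0) - (if z = b then X else 0)) + c • R (Fr z) X := by
  rw [add_smul, sub_smul]
  congr 2
  · by_cases h : z = torusT P i μ b
    · rw [if_pos h, if_pos (by rw [h, torusT_apply]), one_smul, h, hpole]
    · rw [if_neg h, if_neg (by rwa [torusT_apply] at h), zero_smul]
  · by_cases h : z = b
    · rw [if_pos h, if_pos h, one_smul, h, hFr1, R_def]; simp
    · rw [if_neg h, if_neg h, zero_smul]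

/-! ## §2 ★★★ The body of `htr` from displayed rows -/

/-- ★★★ **THE (A-cov) TRANSPLANT ASSEMBLY** (see the module docstring): the `∃ V h s χ u Nh N₂ N₃ N₄ H S, …` body of ✓p677235's `htr` at the test matrix `X`, from gen-0's scalars∕identities, gen-1's fields in
✓p678447's letters, the near data, the anchor, ten displayed numbers and the displayed total. [cite: Balaban1985BackgroundPropagators, (3.3) p.390, (3.8) p.392, (3.35) p.396; Balaban1985RegularSpaces, (1.14) p.78,
(1.36) p.82; Balaban1984PropagatorsII, (1.9) p.226] -/
theorem htr_body_of_rows [DecidableEq (Site P i)] (U : Fin P.d → Site P i → (Matrix (Fin N) (Fin N) ℂ)ˣ) (Fr : Site P i → (Matrix (Fin N) (Fin N) ℂ)ˣ) (C : Set (Site P i))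
    (b : Site P i) (μ₀ : Fin P.d) (X : Matrix (Fin N) (Fin N) ℂ)
    -- the anchor
    (hFr1 : Fr b = 1) (hpole : Fr (torusT P i μ₀ b) = (U μ₀ b)⁻¹)
    -- gen-0 scalars and the near scalar
    (ψ g c₁ c₂ ψt : Site P i → ℝ)
    (hid1 : ∀ z, ∑ ν : Fin P.d, (2 * ψ z - ψ (torusT P i ν z) - ψ ((torusT P i ν).symm z)) = g z + c₁ z)
    (hid2 : ∀ z, ∑ ν : Fin P.d, (2 * g z - g (torusT P i ν z) - g ((torusT P i ν).symm z))
      = ((if z = b.shift μ₀ then (1 : ℝ) else 0) - (if z = b then (1 : ℝ) else 0)) + c₂ z)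
    (hψt : ∀ y ∈ C, ψt y = ψ y)
    -- gen-1 fields (✓p678447 letters) and the gen-1 near datum
    (F J m E₁ E₂ K₁ K₂ u₁ : Site P i → Matrix (Fin N) (Fin N) ℂ)
    (hE₁ : ∀ z, E₁ z = divB (torusT P i) U (fun μ => covD (torusT P i) U μ (fun y => ψ y • R (Fr y) X)) z
      - (∑ μ : Fin P.d, (2 * ψ z - ψ (torusT P i μ z) - ψ ((torusT P i μ).symm z))) • R (Fr z) X)
    (hE₂ : ∀ z, E₂ z = divB (torusT P i) U (fun μ => covD (torusT P i) U μ (fun y => g y • R (Fr y) X)) z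
      - (∑ ν : Fin P.d, (2 * g z - g (torusT P i ν z) - g ((torusT P i ν).symm z))) • R (Fr z) X)
    (hK₁ : ∀ z, K₁ z = divB (torusT P i) U (fun μ => covD (torusT P i) U μ (fun y => R (Fr y) (F y))) z
      - R (Fr z) (∑ μ : Fin P.d, ((F z - F (torusT P i μ z)) + (F z - F ((torusT P i μ).symm z)))))
    (hK₂ : ∀ z, K₂ z = divB (torusT P i) U (fun μ => covD (torusT P i) U μ
        (fun y => R (Fr y) (∑ μ : Fin P.d, ((F y - F (torusT P i μ y)) + (F y - F ((torusT P i μ).symm y)))))) z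
      - R (Fr z) (∑ ν : Fin P.d, (((∑ μ : Fin P.d, ((F z - F (torusT P i μ z)) + (F z - F ((torusT P i μ).symm z))))
          - (∑ μ : Fin P.d, ((F (torusT P i ν z) - F (torusT P i μ (torusT P i ν z))) + (F (torusT P i ν z) - F ((torusT P i μ).symm (torusT P i ν z))))))
          + ((∑ μ : Fin P.d, ((F z - F (torusT P i μ z)) + (F z - F ((torusT P i μ).symm z))))
          - (∑ μ : Fin P.d, ((F ((torusT P i ν).symm z) - F (torusT P i μ ((torusT P i ν).symm z)))
              + (F ((torusT P i ν).symm z) - F ((torusT P i μ).symm ((torusT P i ν).symm z)))))))))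
    (hF : ∀ z, (∑ ν : Fin P.d, (((∑ μ : Fin P.d, ((F z - F (torusT P i μ z)) + (F z - F ((torusT P i μ).symm z))))
          - (∑ μ : Fin P.d, ((F (torusT P i ν z) - F (torusT P i μ (torusT P i ν z))) + (F (torusT P i ν z) - F ((torusT P i μ).symm (torusT P i ν z))))))
          + ((∑ μ : Fin P.d, ((F z - F (torusT P i μ z)) + (F z - F ((torusT P i μ).symm z))))
          - (∑ μ : Fin P.d, ((F ((torusT P i ν).symm z) - F (torusT P i μ ((torusT P i ν).symm z)))
              + (F ((torusT P i ν).symm z) - F ((torusT P i μ).symm ((torusT P i ν).symm z)))))))) = J z - m z)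
    (hJ : ∀ z, R (Fr z) (J z) = E₂ z)
    (hm : ∀ z ∉ C, m z = 0)
    (hu₁ : ∀ y ∈ C, u₁ y = R (Fr y) (F y))
    -- the weight and the ten numbers
    (ω : Site P i → ℝ) {W A κ N2₀ N2₁ N3₀ N3₁ N4₀ N4₁ H₀ H₁ S₀ S₁ : ℝ}
    (hN2₀ : ∑ z, Real.sqrt (∑ j : Fin N, ∑ k : Fin N, ‖(divB (torusT P i) U (fun μ => covD (torusT P i) U μ (fun y => ψ y • R (Fr y) X)) z) j k‖ ^ 2) ≤ N2₀)
    (hN2₁ : ∑ z, Real.sqrt (∑ j : Fin N, ∑ k : Fin N, ‖(divB (torusT P i) U (fun μ => covD (torusT P i) U μ (fun y => R (Fr y) (F y))) z) j k‖ ^ 2) ≤ N2₁)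
    (hN3₀ : ∑ z, Real.sqrt (∑ j : Fin N, ∑ k : Fin N, ‖(divB (torusT P i) U (fun μ => covD (torusT P i) U μ (fun y => ψt y • R (Fr y) X)) z) j k‖ ^ 2) ≤ N3₀)
    (hN3₁ : ∑ z, Real.sqrt (∑ j : Fin N, ∑ k : Fin N, ‖(divB (torusT P i) U (fun μ => covD (torusT P i) U μ u₁) z) j k‖ ^ 2) ≤ N3₁)
    (hN4₀ : Real.sqrt (∑ z, ω z ^ 2 * ∑ j : Fin N, ∑ k : Fin N, ‖(divB (torusT P i) U (fun μ => covD (torusT P i) U μ (fun y => ψt y • R (Fr y) X)) z) j k‖ ^ 2) ≤ N4₀)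
    (hN4₁ : Real.sqrt (∑ z, ω z ^ 2 * ∑ j : Fin N, ∑ k : Fin N, ‖(divB (torusT P i) U (fun μ => covD (torusT P i) U μ u₁) z) j k‖ ^ 2) ≤ N4₁)
    (hH₀ : Real.sqrt (∑ z, ω z ^ 2 * ∑ j : Fin N, ∑ k : Fin N, ‖(E₁ z + c₁ z • R (Fr z) X) j k‖ ^ 2) ≤ H₀)
    (hH₁ : Real.sqrt (∑ z, ω z ^ 2 * ∑ j : Fin N, ∑ k : Fin N, ‖(K₁ z) j k‖ ^ 2) ≤ H₁)
    (hS₀ : Real.sqrt (∑ z, ω z ^ 2 * ∑ j : Fin N, ∑ k : Fin N, ‖(c₂ z • R (Fr z) X) j k‖ ^ 2) ≤ S₀)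
    (hS₁ : Real.sqrt (∑ z, ω z ^ 2 * ∑ j : Fin N, ∑ k : Fin N, ‖(K₂ z) j k‖ ^ 2) ≤ S₁)
    (htot : W * (3 * 0) + (N2₀ + N2₁) + (N3₀ + N3₁) + W * (3 * (N4₀ + N4₁)) + W * (3 * (H₀ + H₁) + 5 * A * (S₀ + S₁))
      ≤ κ * Real.sqrt (∑ j : Fin N, ∑ k : Fin N, ‖X j k‖ ^ 2)) :
    ∃ (V h s : Site P i → Matrix (Fin N) (Fin N) ℂ) (χ : Site P i → ℝ) (u : Site P i → Matrix (Fin N) (Fin N) ℂ) (Nh N₂ N₃ N₄ H S : ℝ),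
      (∀ z ∉ C, divB (torusT P i) U (fun κ' => covD (torusT P i) U κ'
        (fun y => divB (torusT P i) U (fun ν => covD (torusT P i) U ν V) y)) z
          = ((if z = torusT P i μ₀ b then R (U μ₀ b)⁻¹ X else 0) - (if z = b then X else 0))
            + (divB (torusT P i) U (fun κ' => covD (torusT P i) U κ' h) z + s z)) ∧
      (∀ y ∈ C, u y = χ y • V y) ∧
      Real.sqrt (∑ z, ω z ^ 2 * ∑ j : Fin N, ∑ k : Fin N,
        ‖(divB (torusT P i) U (fun κ' => covD (torusT P i) U κ' (fun y => (1 - χ y) • V y)) z) j k‖ ^ 2) ≤ Nh ∧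
      ∑ z, Real.sqrt (∑ j : Fin N, ∑ k : Fin N, ‖(divB (torusT P i) U (fun κ' => covD (torusT P i) U κ' (fun y => χ y • V y)) z) j k‖ ^ 2) ≤ N₂ ∧
      ∑ z, Real.sqrt (∑ j : Fin N, ∑ k : Fin N, ‖(divB (torusT P i) U (fun κ' => covD (torusT P i) U κ' u) z) j k‖ ^ 2) ≤ N₃ ∧
      Real.sqrt (∑ z, ω z ^ 2 * ∑ j : Fin N, ∑ k : Fin N, ‖(divB (torusT P i) U (fun κ' => covD (torusT P i) U κ' u) z) j k‖ ^ 2) ≤ N₄ ∧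
      Real.sqrt (∑ z, ω z ^ 2 * ∑ j : Fin N, ∑ k : Fin N, ‖(h z) j k‖ ^ 2) ≤ H ∧
      Real.sqrt (∑ z, ω z ^ 2 * ∑ j : Fin N, ∑ k : Fin N, ‖(s z) j k‖ ^ 2) ≤ S ∧
      W * (3 * Nh) + N₂ + N₃ + W * (3 * N₄) + W * (3 * H + 5 * A * S) ≤ κ * Real.sqrt (∑ j : Fin N, ∑ k : Fin N, ‖X j k‖ ^ 2) := by
  refine ⟨fun z => ψ z • R (Fr z) X - R (Fr z) (F z), fun z => E₁ z + c₁ z • R (Fr z) X - K₁ z, fun z => c₂ z • R (Fr z) X - K₂ z, fun _ => 1,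
    fun z => ψt z • R (Fr z) X - u₁ z, 0, N2₀ + N2₁, N3₀ + N3₁, N4₀ + N4₁, H₀ + H₁, S₀ + S₁, ?_, ?_, ?_, ?_, ?_, ?_, ?_, ?_, htot⟩
  · -- the identity off the centres: (ID′) + the anchor + `m = 0` off `C`
    intro z hz
    beta_reduce
    have hID := covBilaplace_two_generation' U Fr ψ g c₁ X F J m E₁ E₂ K₁ K₂ hid1 hE₁ hE₂ hK₁ hK₂ hF hJ z
    rw [hID, hid2 z, dipole_smul_R_eq U Fr b μ₀ hFr1 hpole X (c₂ z) z, hm z hz, B9Eq39Adjoint.R_zero, add_zero]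
    generalize ((if z = torusT P i μ₀ b then R (U μ₀ b)⁻¹ X else 0) - (if z = b then X else 0)) = D₁
    generalize divB (torusT P i) U (fun κ' => covD (torusT P i) U κ' (fun y => E₁ y + c₁ y • R (Fr y) X - K₁ y)) z = D₂
    generalize c₂ z • R (Fr z) X = D₃
    generalize K₂ z = D₄
    abel
  · -- the near datum agrees with `V` on the centres
    intro y hy
    show ψt y • R (Fr y) X - u₁ y = (1 : ℝ) • (ψ y • R (Fr y) X - R (Fr y) (F y))
    rw [one_smul, hψt y hy, hu₁ y hy]
  · -- `N_h = 0`: `(1 − 1)•V = 0`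
    have e : (fun y => ((1 : ℝ) - (fun _ : Site P i => (1 : ℝ)) y) • (ψ y • R (Fr y) X - R (Fr y) (F y))) = fun _ : Site P i => (0 : Matrix (Fin N) (Fin N) ℂ) :=
      funext fun y => by simp only [sub_self, zero_smul]
    rw [e]
    simp only [covLaplace_zero, Matrix.zero_apply, norm_zero, ne_eq, OfNat.ofNat_ne_zero, not_false_eq_true, zero_pow, Finset.sum_const_zero, mul_zero,
      Real.sqrt_zero, le_refl]
  · -- `N₂`: `1•V = V`, triangle
    have e : (fun y => (fun _ : Site P i => (1 : ℝ)) y • (ψ y • R (Fr y) X - R (Fr y) (F y))) = fun y => ψ y • R (Fr y) X - R (Fr y) (F y) :=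
      funext fun y => by simp only [one_smul]
    rw [e]
    exact (sum_sqrt_hs_covLaplace_sub_le (U := U) (fun y => ψ y • R (Fr y) X) (fun y => R (Fr y) (F y))).trans (add_le_add hN2₀ hN2₁)
  · -- `N₃`
    exact (sum_sqrt_hs_covLaplace_sub_le (U := U) (fun y => ψt y • R (Fr y) X) u₁).trans (add_le_add hN3₀ hN3₁)
  · -- `N₄`
    exact (sqrt_weighted_hs_covLaplace_sub_le U ω (fun y => ψt y • R (Fr y) X) u₁).trans (add_le_add hN4₀ hN4₁)
  · -- `H`
    exact (sqrt_weighted_hs_sub_le ω (fun z => E₁ z + c₁ z • R (Fr z) X) K₁).trans (add_le_add hH₀ hH₁)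
  · -- `S`
    exact (sqrt_weighted_hs_sub_le ω (fun z => c₂ z • R (Fr z) X) K₂).trans (add_le_add hS₀ hS₁)

open Summit.QuantumFields.YangMills.Theorems.Prop7TransplantTwoGen (covBilaplace_two_generation'') in
/-- ★★★ **THE (A-cov) TRANSPLANT ASSEMBLY, BOTH HALVES SPLIT** (v1.1 append, px22 g3 (G1-b) ∕ routeR-w6 g6 ✓ `covBilaplace_two_generation''`): as ✓ `htr_body_of_rows`, with gen-1's flat Laplacian split
`Δ_flat F = F′ + c₁′` (`hFsplit`), the second comparison `hK₂` and the flat identity `hF′` taken on `F′`, the type-1 junk `h := E₁ + c₁•R(Fr)X − K₁ − R(Fr)c₁′`, and gen-1's type-1 number read as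
`√Σω²hs(K₁ + R(Fr)c₁′) ≤ H₁`; conclusion = the `htr` body of ✓p677235 at `X`, letter for letter. [cite: Balaban1985BackgroundPropagators, (3.3) p.390, (3.8) p.392, (3.35) p.396; Balaban1985RegularSpaces, (1.36) p.82;
Balaban1984PropagatorsII, (1.9) p.226] -/
theorem htr_body_of_rows'' [DecidableEq (Site P i)] (U : Fin P.d → Site P i → (Matrix (Fin N) (Fin N) ℂ)ˣ) (Fr : Site P i → (Matrix (Fin N) (Fin N) ℂ)ˣ) (C : Set (Site P i))
    (b : Site P i) (μ₀ : Fin P.d) (X : Matrix (Fin N) (Fin N) ℂ)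
    (hFr1 : Fr b = 1) (hpole : Fr (torusT P i μ₀ b) = (U μ₀ b)⁻¹)
    (ψ g c₁ c₂ ψt : Site P i → ℝ)
    (hid1 : ∀ z, ∑ ν : Fin P.d, (2 * ψ z - ψ (torusT P i ν z) - ψ ((torusT P i ν).symm z)) = g z + c₁ z)
    (hid2 : ∀ z, ∑ ν : Fin P.d, (2 * g z - g (torusT P i ν z) - g ((torusT P i ν).symm z))
      = ((if z = b.shift μ₀ then (1 : ℝ) else 0) - (if z = b then (1 : ℝ) else 0)) + c₂ z)
    (hψt : ∀ y ∈ C, ψt y = ψ y)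
    (F F' c₁' J m E₁ E₂ K₁ K₂ u₁ : Site P i → Matrix (Fin N) (Fin N) ℂ)
    (hE₁ : ∀ z, E₁ z = divB (torusT P i) U (fun μ => covD (torusT P i) U μ (fun y => ψ y • R (Fr y) X)) z
      - (∑ μ : Fin P.d, (2 * ψ z - ψ (torusT P i μ z) - ψ ((torusT P i μ).symm z))) • R (Fr z) X)
    (hE₂ : ∀ z, E₂ z = divB (torusT P i) U (fun μ => covD (torusT P i) U μ (fun y => g y • R (Fr y) X)) z
      - (∑ ν : Fin P.d, (2 * g z - g (torusT P i ν z) - g ((torusT P i ν).symm z))) • R (Fr z) X)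
    (hK₁ : ∀ z, K₁ z = divB (torusT P i) U (fun μ => covD (torusT P i) U μ (fun y => R (Fr y) (F y))) z
      - R (Fr z) (∑ μ : Fin P.d, ((F z - F (torusT P i μ z)) + (F z - F ((torusT P i μ).symm z)))))
    (hFsplit : ∀ z, (∑ μ : Fin P.d, ((F z - F (torusT P i μ z)) + (F z - F ((torusT P i μ).symm z)))) = F' z + c₁' z)
    (hK₂ : ∀ z, K₂ z = divB (torusT P i) U (fun μ => covD (torusT P i) U μ (fun y => R (Fr y) (F' y))) z
      - R (Fr z) (∑ ν : Fin P.d, ((F' z - F' (torusT P i ν z)) + (F' z - F' ((torusT P i ν).symm z)))))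
    (hF' : ∀ z, (∑ ν : Fin P.d, ((F' z - F' (torusT P i ν z)) + (F' z - F' ((torusT P i ν).symm z)))) = J z - m z)
    (hJ : ∀ z, R (Fr z) (J z) = E₂ z)
    (hm : ∀ z ∉ C, m z = 0)
    (hu₁ : ∀ y ∈ C, u₁ y = R (Fr y) (F y))
    (ω : Site P i → ℝ) {W A κ N2₀ N2₁ N3₀ N3₁ N4₀ N4₁ H₀ H₁ S₀ S₁ : ℝ}
    (hN2₀ : ∑ z, Real.sqrt (∑ j : Fin N, ∑ k : Fin N, ‖(divB (torusT P i) U (fun μ => covD (torusT P i) U μ (fun y => ψ y • R (Fr y) X)) z) j k‖ ^ 2) ≤ N2₀)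
    (hN2₁ : ∑ z, Real.sqrt (∑ j : Fin N, ∑ k : Fin N, ‖(divB (torusT P i) U (fun μ => covD (torusT P i) U μ (fun y => R (Fr y) (F y))) z) j k‖ ^ 2) ≤ N2₁)
    (hN3₀ : ∑ z, Real.sqrt (∑ j : Fin N, ∑ k : Fin N, ‖(divB (torusT P i) U (fun μ => covD (torusT P i) U μ (fun y => ψt y • R (Fr y) X)) z) j k‖ ^ 2) ≤ N3₀)
    (hN3₁ : ∑ z, Real.sqrt (∑ j : Fin N, ∑ k : Fin N, ‖(divB (torusT P i) U (fun μ => covD (torusT P i) U μ u₁) z) j k‖ ^ 2) ≤ N3₁)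
    (hN4₀ : Real.sqrt (∑ z, ω z ^ 2 * ∑ j : Fin N, ∑ k : Fin N, ‖(divB (torusT P i) U (fun μ => covD (torusT P i) U μ (fun y => ψt y • R (Fr y) X)) z) j k‖ ^ 2) ≤ N4₀)
    (hN4₁ : Real.sqrt (∑ z, ω z ^ 2 * ∑ j : Fin N, ∑ k : Fin N, ‖(divB (torusT P i) U (fun μ => covD (torusT P i) U μ u₁) z) j k‖ ^ 2) ≤ N4₁)
    (hH₀ : Real.sqrt (∑ z, ω z ^ 2 * ∑ j : Fin N, ∑ k : Fin N, ‖(E₁ z + c₁ z • R (Fr z) X) j k‖ ^ 2) ≤ H₀)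
    (hH₁ : Real.sqrt (∑ z, ω z ^ 2 * ∑ j : Fin N, ∑ k : Fin N, ‖(K₁ z + R (Fr z) (c₁' z)) j k‖ ^ 2) ≤ H₁)
    (hS₀ : Real.sqrt (∑ z, ω z ^ 2 * ∑ j : Fin N, ∑ k : Fin N, ‖(c₂ z • R (Fr z) X) j k‖ ^ 2) ≤ S₀)
    (hS₁ : Real.sqrt (∑ z, ω z ^ 2 * ∑ j : Fin N, ∑ k : Fin N, ‖(K₂ z) j k‖ ^ 2) ≤ S₁)
    (htot : W * (3 * 0) + (N2₀ + N2₁) + (N3₀ + N3₁) + W * (3 * (N4₀ + N4₁)) + W * (3 * (H₀ + H₁) + 5 * A * (S₀ + S₁))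
      ≤ κ * Real.sqrt (∑ j : Fin N, ∑ k : Fin N, ‖X j k‖ ^ 2)) :
    ∃ (V h s : Site P i → Matrix (Fin N) (Fin N) ℂ) (χ : Site P i → ℝ) (u : Site P i → Matrix (Fin N) (Fin N) ℂ) (Nh N₂ N₃ N₄ H S : ℝ),
      (∀ z ∉ C, divB (torusT P i) U (fun κ' => covD (torusT P i) U κ'
        (fun y => divB (torusT P i) U (fun ν => covD (torusT P i) U ν V) y)) z
          = ((if z = torusT P i μ₀ b then R (U μ₀ b)⁻¹ X else 0) - (if z = b then X else 0))
            + (divB (torusT P i) U (fun κ' => covD (torusT P i) U κ' h) z + s z)) ∧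
      (∀ y ∈ C, u y = χ y • V y) ∧
      Real.sqrt (∑ z, ω z ^ 2 * ∑ j : Fin N, ∑ k : Fin N,
        ‖(divB (torusT P i) U (fun κ' => covD (torusT P i) U κ' (fun y => (1 - χ y) • V y)) z) j k‖ ^ 2) ≤ Nh ∧
      ∑ z, Real.sqrt (∑ j : Fin N, ∑ k : Fin N, ‖(divB (torusT P i) U (fun κ' => covD (torusT P i) U κ' (fun y => χ y • V y)) z) j k‖ ^ 2) ≤ N₂ ∧
      ∑ z, Real.sqrt (∑ j : Fin N, ∑ k : Fin N, ‖(divB (torusT P i) U (fun κ' => covD (torusT P i) U κ' u) z) j k‖ ^ 2) ≤ N₃ ∧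
      Real.sqrt (∑ z, ω z ^ 2 * ∑ j : Fin N, ∑ k : Fin N, ‖(divB (torusT P i) U (fun κ' => covD (torusT P i) U κ' u) z) j k‖ ^ 2) ≤ N₄ ∧
      Real.sqrt (∑ z, ω z ^ 2 * ∑ j : Fin N, ∑ k : Fin N, ‖(h z) j k‖ ^ 2) ≤ H ∧
      Real.sqrt (∑ z, ω z ^ 2 * ∑ j : Fin N, ∑ k : Fin N, ‖(s z) j k‖ ^ 2) ≤ S ∧
      W * (3 * Nh) + N₂ + N₃ + W * (3 * N₄) + W * (3 * H + 5 * A * S) ≤ κ * Real.sqrt (∑ j : Fin N, ∑ k : Fin N, ‖X j k‖ ^ 2) := by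
  refine ⟨fun z => ψ z • R (Fr z) X - R (Fr z) (F z), fun z => E₁ z + c₁ z • R (Fr z) X - K₁ z - R (Fr z) (c₁' z), fun z => c₂ z • R (Fr z) X - K₂ z, fun _ => 1,
    fun z => ψt z • R (Fr z) X - u₁ z, 0, N2₀ + N2₁, N3₀ + N3₁, N4₀ + N4₁, H₀ + H₁, S₀ + S₁, ?_, ?_, ?_, ?_, ?_, ?_, ?_, ?_, htot⟩
  · intro z hz
    beta_reduce
    have hID := covBilaplace_two_generation'' U Fr ψ g c₁ X F F' c₁' J m E₁ E₂ K₁ K₂ hid1 hE₁ hE₂ hK₁ hFsplit hK₂ hF' hJ z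
    rw [hID, hid2 z, dipole_smul_R_eq U Fr b μ₀ hFr1 hpole X (c₂ z) z, hm z hz, B9Eq39Adjoint.R_zero, add_zero]
    generalize ((if z = torusT P i μ₀ b then R (U μ₀ b)⁻¹ X else 0) - (if z = b then X else 0)) = D₁
    generalize divB (torusT P i) U (fun κ' => covD (torusT P i) U κ' (fun y => E₁ y + c₁ y • R (Fr y) X - K₁ y - R (Fr y) (c₁' y))) z = D₂
    generalize c₂ z • R (Fr z) X = D₃
    generalize K₂ z = D₄
    abel
  · intro y hy
    show ψt y • R (Fr y) X - u₁ y = (1 : ℝ) • (ψ y • R (Fr y) X - R (Fr y) (F y))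
    rw [one_smul, hψt y hy, hu₁ y hy]
  · have e : (fun y => ((1 : ℝ) - (fun _ : Site P i => (1 : ℝ)) y) • (ψ y • R (Fr y) X - R (Fr y) (F y))) = fun _ : Site P i => (0 : Matrix (Fin N) (Fin N) ℂ) :=
      funext fun y => by simp only [sub_self, zero_smul]
    rw [e]
    simp only [covLaplace_zero, Matrix.zero_apply, norm_zero, ne_eq, OfNat.ofNat_ne_zero, not_false_eq_true, zero_pow, Finset.sum_const_zero, mul_zero,
      Real.sqrt_zero, le_refl]
  · have e : (fun y => (fun _ : Site P i => (1 : ℝ)) y • (ψ y • R (Fr y) X - R (Fr y) (F y))) = fun y => ψ y • R (Fr y) X - R (Fr y) (F y) :=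
      funext fun y => by simp only [one_smul]
    rw [e]
    exact (sum_sqrt_hs_covLaplace_sub_le (U := U) (fun y => ψ y • R (Fr y) X) (fun y => R (Fr y) (F y))).trans (add_le_add hN2₀ hN2₁)
  · exact (sum_sqrt_hs_covLaplace_sub_le (U := U) (fun y => ψt y • R (Fr y) X) u₁).trans (add_le_add hN3₀ hN3₁)
  · exact (sqrt_weighted_hs_covLaplace_sub_le U ω (fun y => ψt y • R (Fr y) X) u₁).trans (add_le_add hN4₀ hN4₁)
  · -- `H`: `h = (E₁ + c₁•RX) − (K₁ + R(Fr)c₁′)` up to associativity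
    beta_reduce
    have e : ∀ z, E₁ z + c₁ z • R (Fr z) X - K₁ z - R (Fr z) (c₁' z) = (E₁ z + c₁ z • R (Fr z) X) - (K₁ z + R (Fr z) (c₁' z)) := fun z => by abel
    simp only [e]
    exact (sqrt_weighted_hs_sub_le ω (fun z => E₁ z + c₁ z • R (Fr z) X) (fun z => K₁ z + R (Fr z) (c₁' z))).trans (add_le_add hH₀ hH₁)
  · exact (sqrt_weighted_hs_sub_le ω (fun z => c₂ z • R (Fr z) X) K₂).trans (add_le_add hS₀ hS₁)

open Summit.QuantumFields.YangMills.Theorems.Prop7TransplantTwoGen (covBilaplace_two_generation'') in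
/-- ★★★ **v1.2: BOTH HALVES SPLIT + gen-1's SITE REMAINDER `c₂′`** (routeR-w6 g7 ∕ px11 g4 00:20Z: a compactly supported `F′` cannot solve `Δ_flat F′ = J − m` with `m` off-centre-free): as `''` with
`hF′ : Δ_flat F′ = J − m − c₂′`, gen-1's site number `√Σω²hs(K₂ − R(Fr)c₂′) ≤ S₁`, witness `s := c₂•R(Fr)X − (K₂ − R(Fr)c₂′)`; conclusion = ✓p677235's `htr` body. [cite: Balaban1985BackgroundPropagators, (3.8) p.392] -/
theorem htr_body_of_rows''' [DecidableEq (Site P i)] (U : Fin P.d → Site P i → (Matrix (Fin N) (Fin N) ℂ)ˣ) (Fr : Site P i → (Matrix (Fin N) (Fin N) ℂ)ˣ) (C : Set (Site P i))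
    (b : Site P i) (μ₀ : Fin P.d) (X : Matrix (Fin N) (Fin N) ℂ)
    (hFr1 : Fr b = 1) (hpole : Fr (torusT P i μ₀ b) = (U μ₀ b)⁻¹)
    (ψ g c₁ c₂ ψt : Site P i → ℝ)
    (hid1 : ∀ z, ∑ ν : Fin P.d, (2 * ψ z - ψ (torusT P i ν z) - ψ ((torusT P i ν).symm z)) = g z + c₁ z)
    (hid2 : ∀ z, ∑ ν : Fin P.d, (2 * g z - g (torusT P i ν z) - g ((torusT P i ν).symm z))
      = ((if z = b.shift μ₀ then (1 : ℝ) else 0) - (if z = b then (1 : ℝ) else 0)) + c₂ z)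
    (hψt : ∀ y ∈ C, ψt y = ψ y)
    (F F' c₁' c₂' J m E₁ E₂ K₁ K₂ u₁ : Site P i → Matrix (Fin N) (Fin N) ℂ)
    (hE₁ : ∀ z, E₁ z = divB (torusT P i) U (fun μ => covD (torusT P i) U μ (fun y => ψ y • R (Fr y) X)) z
      - (∑ μ : Fin P.d, (2 * ψ z - ψ (torusT P i μ z) - ψ ((torusT P i μ).symm z))) • R (Fr z) X)
    (hE₂ : ∀ z, E₂ z = divB (torusT P i) U (fun μ => covD (torusT P i) U μ (fun y => g y • R (Fr y) X)) z
      - (∑ ν : Fin P.d, (2 * g z - g (torusT P i ν z) - g ((torusT P i ν).symm z))) • R (Fr z) X)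
    (hK₁ : ∀ z, K₁ z = divB (torusT P i) U (fun μ => covD (torusT P i) U μ (fun y => R (Fr y) (F y))) z
      - R (Fr z) (∑ μ : Fin P.d, ((F z - F (torusT P i μ z)) + (F z - F ((torusT P i μ).symm z)))))
    (hFsplit : ∀ z, (∑ μ : Fin P.d, ((F z - F (torusT P i μ z)) + (F z - F ((torusT P i μ).symm z)))) = F' z + c₁' z)
    (hK₂ : ∀ z, K₂ z = divB (torusT P i) U (fun μ => covD (torusT P i) U μ (fun y => R (Fr y) (F' y))) z
      - R (Fr z) (∑ ν : Fin P.d, ((F' z - F' (torusT P i ν z)) + (F' z - F' ((torusT P i ν).symm z)))))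
    (hF' : ∀ z, (∑ ν : Fin P.d, ((F' z - F' (torusT P i ν z)) + (F' z - F' ((torusT P i ν).symm z)))) = J z - m z - c₂' z)
    (hJ : ∀ z, R (Fr z) (J z) = E₂ z)
    (hm : ∀ z ∉ C, m z = 0)
    (hu₁ : ∀ y ∈ C, u₁ y = R (Fr y) (F y))
    (ω : Site P i → ℝ) {W A κ N2₀ N2₁ N3₀ N3₁ N4₀ N4₁ H₀ H₁ S₀ S₁ : ℝ}
    (hN2₀ : ∑ z, Real.sqrt (∑ j : Fin N, ∑ k : Fin N, ‖(divB (torusT P i) U (fun μ => covD (torusT P i) U μ (fun y => ψ y • R (Fr y) X)) z) j k‖ ^ 2) ≤ N2₀)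
    (hN2₁ : ∑ z, Real.sqrt (∑ j : Fin N, ∑ k : Fin N, ‖(divB (torusT P i) U (fun μ => covD (torusT P i) U μ (fun y => R (Fr y) (F y))) z) j k‖ ^ 2) ≤ N2₁)
    (hN3₀ : ∑ z, Real.sqrt (∑ j : Fin N, ∑ k : Fin N, ‖(divB (torusT P i) U (fun μ => covD (torusT P i) U μ (fun y => ψt y • R (Fr y) X)) z) j k‖ ^ 2) ≤ N3₀)
    (hN3₁ : ∑ z, Real.sqrt (∑ j : Fin N, ∑ k : Fin N, ‖(divB (torusT P i) U (fun μ => covD (torusT P i) U μ u₁) z) j k‖ ^ 2) ≤ N3₁)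
    (hN4₀ : Real.sqrt (∑ z, ω z ^ 2 * ∑ j : Fin N, ∑ k : Fin N, ‖(divB (torusT P i) U (fun μ => covD (torusT P i) U μ (fun y => ψt y • R (Fr y) X)) z) j k‖ ^ 2) ≤ N4₀)
    (hN4₁ : Real.sqrt (∑ z, ω z ^ 2 * ∑ j : Fin N, ∑ k : Fin N, ‖(divB (torusT P i) U (fun μ => covD (torusT P i) U μ u₁) z) j k‖ ^ 2) ≤ N4₁)
    (hH₀ : Real.sqrt (∑ z, ω z ^ 2 * ∑ j : Fin N, ∑ k : Fin N, ‖(E₁ z + c₁ z • R (Fr z) X) j k‖ ^ 2) ≤ H₀)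
    (hH₁ : Real.sqrt (∑ z, ω z ^ 2 * ∑ j : Fin N, ∑ k : Fin N, ‖(K₁ z + R (Fr z) (c₁' z)) j k‖ ^ 2) ≤ H₁)
    (hS₀ : Real.sqrt (∑ z, ω z ^ 2 * ∑ j : Fin N, ∑ k : Fin N, ‖(c₂ z • R (Fr z) X) j k‖ ^ 2) ≤ S₀)
    (hS₁ : Real.sqrt (∑ z, ω z ^ 2 * ∑ j : Fin N, ∑ k : Fin N, ‖(K₂ z - R (Fr z) (c₂' z)) j k‖ ^ 2) ≤ S₁)
    (htot : W * (3 * 0) + (N2₀ + N2₁) + (N3₀ + N3₁) + W * (3 * (N4₀ + N4₁)) + W * (3 * (H₀ + H₁) + 5 * A * (S₀ + S₁))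
      ≤ κ * Real.sqrt (∑ j : Fin N, ∑ k : Fin N, ‖X j k‖ ^ 2)) :
    ∃ (V h s : Site P i → Matrix (Fin N) (Fin N) ℂ) (χ : Site P i → ℝ) (u : Site P i → Matrix (Fin N) (Fin N) ℂ) (Nh N₂ N₃ N₄ H S : ℝ),
      (∀ z ∉ C, divB (torusT P i) U (fun κ' => covD (torusT P i) U κ'
        (fun y => divB (torusT P i) U (fun ν => covD (torusT P i) U ν V) y)) z
          = ((if z = torusT P i μ₀ b then R (U μ₀ b)⁻¹ X else 0) - (if z = b then X else 0))
            + (divB (torusT P i) U (fun κ' => covD (torusT P i) U κ' h) z + s z)) ∧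
      (∀ y ∈ C, u y = χ y • V y) ∧
      Real.sqrt (∑ z, ω z ^ 2 * ∑ j : Fin N, ∑ k : Fin N,
        ‖(divB (torusT P i) U (fun κ' => covD (torusT P i) U κ' (fun y => (1 - χ y) • V y)) z) j k‖ ^ 2) ≤ Nh ∧
      ∑ z, Real.sqrt (∑ j : Fin N, ∑ k : Fin N, ‖(divB (torusT P i) U (fun κ' => covD (torusT P i) U κ' (fun y => χ y • V y)) z) j k‖ ^ 2) ≤ N₂ ∧
      ∑ z, Real.sqrt (∑ j : Fin N, ∑ k : Fin N, ‖(divB (torusT P i) U (fun κ' => covD (torusT P i) U κ' u) z) j k‖ ^ 2) ≤ N₃ ∧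
      Real.sqrt (∑ z, ω z ^ 2 * ∑ j : Fin N, ∑ k : Fin N, ‖(divB (torusT P i) U (fun κ' => covD (torusT P i) U κ' u) z) j k‖ ^ 2) ≤ N₄ ∧
      Real.sqrt (∑ z, ω z ^ 2 * ∑ j : Fin N, ∑ k : Fin N, ‖(h z) j k‖ ^ 2) ≤ H ∧
      Real.sqrt (∑ z, ω z ^ 2 * ∑ j : Fin N, ∑ k : Fin N, ‖(s z) j k‖ ^ 2) ≤ S ∧
      W * (3 * Nh) + N₂ + N₃ + W * (3 * N₄) + W * (3 * H + 5 * A * S) ≤ κ * Real.sqrt (∑ j : Fin N, ∑ k : Fin N, ‖X j k‖ ^ 2) := by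
  refine ⟨fun z => ψ z • R (Fr z) X - R (Fr z) (F z), fun z => E₁ z + c₁ z • R (Fr z) X - K₁ z - R (Fr z) (c₁' z), fun z => c₂ z • R (Fr z) X - (K₂ z - R (Fr z) (c₂' z)), fun _ => 1,
    fun z => ψt z • R (Fr z) X - u₁ z, 0, N2₀ + N2₁, N3₀ + N3₁, N4₀ + N4₁, H₀ + H₁, S₀ + S₁, ?_, ?_, ?_, ?_, ?_, ?_, ?_, ?_, htot⟩
  · intro z hz
    beta_reduce
    have hF'' : ∀ w, (∑ ν : Fin P.d, ((F' w - F' (torusT P i ν w)) + (F' w - F' ((torusT P i ν).symm w)))) = J w - (m w + c₂' w) := fun w => by rw [hF' w]; abel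
    have hID := covBilaplace_two_generation'' U Fr ψ g c₁ X F F' c₁' J (fun w => m w + c₂' w) E₁ E₂ K₁ K₂ hid1 hE₁ hE₂ hK₁ hFsplit hK₂ hF'' hJ z
    rw [hID, hid2 z, dipole_smul_R_eq U Fr b μ₀ hFr1 hpole X (c₂ z) z, hm z hz, zero_add]
    generalize ((if z = torusT P i μ₀ b then R (U μ₀ b)⁻¹ X else 0) - (if z = b then X else 0)) = D₁
    generalize divB (torusT P i) U (fun κ' => covD (torusT P i) U κ' (fun y => E₁ y + c₁ y • R (Fr y) X - K₁ y - R (Fr y) (c₁' y))) z = D₂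
    generalize c₂ z • R (Fr z) X = D₃; generalize K₂ z = D₄; generalize R (Fr z) (c₂' z) = D₅; abel
  · intro y hy; show ψt y • R (Fr y) X - u₁ y = (1 : ℝ) • (ψ y • R (Fr y) X - R (Fr y) (F y)); rw [one_smul, hψt y hy, hu₁ y hy]
  · have e : (fun y => ((1 : ℝ) - (fun _ : Site P i => (1 : ℝ)) y) • (ψ y • R (Fr y) X - R (Fr y) (F y))) = fun _ : Site P i => (0 : Matrix (Fin N) (Fin N) ℂ) :=
      funext fun y => by simp only [sub_self, zero_smul]
    rw [e]
    simp only [covLaplace_zero, Matrix.zero_apply, norm_zero, ne_eq, OfNat.ofNat_ne_zero, not_false_eq_true, zero_pow, Finset.sum_const_zero, mul_zero,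
      Real.sqrt_zero, le_refl]
  · have e : (fun y => (fun _ : Site P i => (1 : ℝ)) y • (ψ y • R (Fr y) X - R (Fr y) (F y))) = fun y => ψ y • R (Fr y) X - R (Fr y) (F y) :=
      funext fun y => by simp only [one_smul]
    rw [e]
    exact (sum_sqrt_hs_covLaplace_sub_le (U := U) (fun y => ψ y • R (Fr y) X) (fun y => R (Fr y) (F y))).trans (add_le_add hN2₀ hN2₁)
  · exact (sum_sqrt_hs_covLaplace_sub_le (U := U) (fun y => ψt y • R (Fr y) X) u₁).trans (add_le_add hN3₀ hN3₁)
  · exact (sqrt_weighted_hs_covLaplace_sub_le U ω (fun y => ψt y • R (Fr y) X) u₁).trans (add_le_add hN4₀ hN4₁)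
  · beta_reduce
    have e : ∀ z, E₁ z + c₁ z • R (Fr z) X - K₁ z - R (Fr z) (c₁' z) = (E₁ z + c₁ z • R (Fr z) X) - (K₁ z + R (Fr z) (c₁' z)) := fun z => by abel
    simp only [e]
    exact (sqrt_weighted_hs_sub_le ω (fun z => E₁ z + c₁ z • R (Fr z) X) (fun z => K₁ z + R (Fr z) (c₁' z))).trans (add_le_add hH₀ hH₁)
  · exact (sqrt_weighted_hs_sub_le ω (fun z => c₂ z • R (Fr z) X) (fun z => K₂ z - R (Fr z) (c₂' z))).trans (add_le_add hS₀ hS₁)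

end Summit.QuantumFields.YangMills.Theorems.Prop7CovKernelTransplantAssembly

end
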